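import Summits.ValiantsHypothesis.ValiantsHypothesis.Theorems.BarrierLeverChowBenchmarkPairsSplitCertCanonical

/-!
# Route BarrierLever — item 22038 `ChowBenchmarkPairs`, line `moore-peel`: SPLIT CERTIFICATES — the QUADRATIC checker `check2`
# (same certificate format; zipped traversals and a structural transpose instead of indexed look-ups) and `check_of_check2`

Helper file (`--supports stmt-ValiantsHypothesis-22038`; cell valiant-natproofs, rung V4; seat val-np-p4 gen 24).  Closes NO item.

The landed checker `Cert.check` (`…SplitCertDefs`) reads list entries by index (`getD` inside `List.ofFn`), which costs `O(n³)` kernel steps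
per level and exhausts the kernel at `n ≈ 67` (`h = 11`).  `check2` runs the SAME levels with lock-step traversals (`rowStep2`, `rowsStep2`) and
permutes columns through a structural transpose (`tr`), `O(n²)` per level; `check_of_check2 : check2 = true → check = true` (the v2 steps
compute literally the v1 instances: `splitStep2_eq`, `permStep2_eq`, by list extensionality through `tr_getD`, `rowsStep2_spec`), so every
soundness consequence of `check` (`exists_table_of_check`, `hsmv_of_check`, `smv_of_hsmv`, …) is available for `check2`-certified instances.
Kernel instances beyond `h = 10` are in `…SplitCertInstancesB`.

WHAT THIS IS NOT: bookkeeping; no stub of the line is closed; nothing on crux stmt-ValiantsHypothesis-14610 or on `VP` versus `VNP`.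
-/

set_option linter.dupNamespace false
set_option autoImplicit false

namespace Summit.ValiantsHypothesis.ValiantsHypothesis.Theorems.BarrierLever.ChowBenchmarkSplit
namespace Cert

open Literature.Computability.Complexity (getD_ofFn)

/-! ## 1. The v2 checker: same levels, quadratic work per level -/

/-- One row of a split, walking the columns (entries, codes, column labels, column potentials in lock-step). -/
def rowStep2 (c : ℕ) (ρ : List ℕ) (a : ℕ) (li : ℕ) (ps : List ℕ) :
    List (ℕ × ℕ × ℕ) → List ℕ → List ℕ → List ℕ → Bool × List (ℕ × ℕ × ℕ)
  | e :: es, m :: ms, lj :: ls, b :: bs =>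
    ((decide (e.1 = 0) || (decide (li = lj) && (newEnt c ρ a b ps e m).1)) && (rowStep2 c ρ a li ps es ms ls bs).1,
      (newEnt c ρ a b ps e m).2 :: (rowStep2 c ρ a li ps es ms ls bs).2)
  | _, _, _, _ => (true, [])

/-- All rows of a split (entry rows, supports, row labels, row potentials in lock-step). -/
def rowsStep2 (c : ℕ) (ords : List (List ℕ)) (cols : List ℕ) (labs : List ℕ) (β : List ℕ) :
    List (List (ℕ × ℕ × ℕ)) → List (List ℕ) → List ℕ → List ℕ → Bool × List (List (ℕ × ℕ × ℕ))
  | row :: rows, ps :: pss, li :: lis, a :: as =>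
    ((rowStep2 c (ords.getD li []) a li ps row cols labs β).1 && (rowsStep2 c ords cols labs β rows pss lis as).1,
      (rowStep2 c (ords.getD li []) a li ps row cols labs β).2 :: (rowsStep2 c ords cols labs β rows pss lis as).2)
  | _, _, _, _ => (true, [])

/-- The instance lists have the expected sizes. -/
def wellSized (n : ℕ) (I : Inst) : Bool :=
  decide (I.sup.length = n) && decide (I.col.length = n) && decide (I.ent.length = n) &&
    I.ent.all fun row => decide (row.length = n)

/-- v2 split step (with size checks on the level data). -/
def splitStep2 (k n : ℕ) (c : ℕ) (lab : List ℕ) (ords : List (List ℕ)) (α β : List ℕ) (I : Inst) : Bool × Inst :=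
  let r := rowsStep2 c ords I.col lab β I.ent I.sup lab α
  (decide (c < k) && decide (lab.length = n) && decide (α.length = n) && decide (β.length = n) && wellSized n I && r.1,
    { sup := I.sup, ent := r.2, col := I.col.map (newCol c) })

/-- Structural transpose of a rectangular list of rows. -/
def tr {α : Type} : List (List α) → List (List α)
  | [] => []
  | [r] => r.map fun x => [x]
  | r :: rs => List.zipWith (fun x col => x :: col) r (tr rs)

/-- v2 permutation step (columns reordered through a transpose; quadratic). -/
def permStep2 (n : ℕ) (σ : List ℕ) (I : Inst) : Bool × Inst :=
  (((List.range n).all fun j => decide (σ.getD j 0 < n)) && decide (List.ofFn fun j : Fin n => σ.getD j 0).Nodup &&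
      decide (σ.length = n) && wellSized n I && decide (0 < n),
    { sup := I.sup, ent := tr (σ.map fun j => (tr I.ent).getD j []), col := σ.map fun j => I.colN j })

/-- **v2 checker** (same certificate format as `check`). -/
def check2 (k n : ℕ) : List Level → Inst → Bool
  | [], I => leafOK n I
  | Level.perm σ :: ls, I => (permStep2 n σ I).1 && check2 k n ls (permStep2 n σ I).2
  | Level.split c lab ords α β :: ls, I =>
      (splitStep2 k n c lab ords α β I).1 && check2 k n ls (splitStep2 k n c lab ords α β I).2

/-! ## 2. The transpose -/

/-- Columns of the transpose of a rectangular nonempty list of rows. -/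
theorem tr_getD {α : Type} (d : α) : ∀ (L : List (List α)) (n : ℕ), L ≠ [] → (∀ r ∈ L, r.length = n) →
    (tr L).length = n ∧ ∀ j, j < n → (tr L).getD j [] = L.map fun r => r.getD j d
  | [], _, h, _ => absurd rfl h
  | [r], n, _, hL => by
    have hr : r.length = n := hL r (by simp)
    refine ⟨by rw [tr, List.length_map, hr], fun j hj => ?_⟩
    rw [tr, List.getD_eq_getElem _ _ (by rw [List.length_map, hr]; exact hj), List.getElem_map, List.map_singleton,
      List.getD_eq_getElem _ _ (by rw [hr]; exact hj)]
  | r :: r' :: rs, n, _, hL => by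
    have hr : r.length = n := hL r (by simp)
    have ih := tr_getD d (r' :: rs) n (List.cons_ne_nil _ _) (fun x hx => hL x (List.mem_cons_of_mem _ hx))
    have hlen : (tr (r :: r' :: rs)).length = n := by
      show (List.zipWith _ r (tr (r' :: rs))).length = n
      rw [List.length_zipWith, hr, ih.1, min_self]
    refine ⟨hlen, fun j hj => ?_⟩
    show (List.zipWith _ r (tr (r' :: rs))).getD j [] = _
    rw [List.getD_eq_getElem _ _ (by rw [List.length_zipWith, hr, ih.1, min_self]; exact hj), List.getElem_zipWith,
      List.map_cons, ← ih.2 j hj, List.getD_eq_getElem _ _ (by rw [hr]; exact hj),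
      List.getD_eq_getElem _ _ (by rw [ih.1]; exact hj)]


/-! ## 3. The v2 steps compute the v1 steps -/

section Equiv2

variable {k n : ℕ}

/-- Pointwise description of one row of the v2 split. -/
theorem rowStep2_spec (c : ℕ) (ρ : List ℕ) (a li : ℕ) (ps : List ℕ) :
    ∀ (es : List (ℕ × ℕ × ℕ)) (ms ls bs : List ℕ), ms.length = es.length → ls.length = es.length → bs.length = es.length →
      (rowStep2 c ρ a li ps es ms ls bs).2.length = es.length ∧
      (∀ j, j < es.length → (rowStep2 c ρ a li ps es ms ls bs).2.getD j (0, 0, 0) =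
        (newEnt c ρ a (bs.getD j 0) ps (es.getD j (0, 0, 0)) (ms.getD j 0)).2) ∧
      ((rowStep2 c ρ a li ps es ms ls bs).1 = true → ∀ j, j < es.length →
        (es.getD j (0, 0, 0)).1 = 0 ∨ (li = ls.getD j 0 ∧ (newEnt c ρ a (bs.getD j 0) ps (es.getD j (0, 0, 0)) (ms.getD j 0)).1 = true))
  | [], ms, ls, bs, _, _, _ => by simp [rowStep2]
  | e :: es, m :: ms, lj :: ls, b :: bs, hm, hl, hb => by
    have ih := rowStep2_spec c ρ a li ps es ms ls bs (by simpa using hm) (by simpa using hl) (by simpa using hb)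
    refine ⟨by simp [rowStep2, ih.1], fun j hj => ?_, fun hok j hj => ?_⟩
    · rcases j with _ | j
      · simp [rowStep2]
      · simp only [rowStep2, List.getD_cons_succ]
        exact ih.2.1 j (by simpa using hj)
    · simp only [rowStep2, Bool.and_eq_true, Bool.or_eq_true, decide_eq_true_eq] at hok
      rcases j with _ | j
      · simp only [List.getD_cons_zero]
        rcases hok.1 with h0 | ⟨h1, h2⟩
        · exact Or.inl h0
        · exact Or.inr ⟨h1, h2⟩
      · simp only [List.getD_cons_succ]
        exact ih.2.2 hok.2 j (by simpa using hj)
  | e :: es, [], ls, bs, hm, _, _ => by simp at hm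
  | e :: es, m :: ms, [], bs, _, hl, _ => by simp at hl
  | e :: es, m :: ms, lj :: ls, [], _, _, hb => by simp at hb

/-- Pointwise description of all rows of the v2 split. -/
theorem rowsStep2_spec (c : ℕ) (ords : List (List ℕ)) (cols labs β : List ℕ) (w : ℕ)
    (hcols : cols.length = w) (hlabs : labs.length = w) (hβ : β.length = w) :
    ∀ (rows : List (List (ℕ × ℕ × ℕ))) (pss : List (List ℕ)) (lis as : List ℕ),
      pss.length = rows.length → lis.length = rows.length → as.length = rows.length → (∀ row ∈ rows, row.length = w) →
      (rowsStep2 c ords cols labs β rows pss lis as).2.length = rows.length ∧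
      (∀ i, i < rows.length →
        ((rowsStep2 c ords cols labs β rows pss lis as).2.getD i []).length = w ∧
        (∀ j, j < w → ((rowsStep2 c ords cols labs β rows pss lis as).2.getD i []).getD j (0, 0, 0) =
          (newEnt c (ords.getD (lis.getD i 0) []) (as.getD i 0) (β.getD j 0) (pss.getD i [])
            ((rows.getD i []).getD j (0, 0, 0)) (cols.getD j 0)).2) ∧
        ((rowsStep2 c ords cols labs β rows pss lis as).1 = true → ∀ j, j < w →
          ((rows.getD i []).getD j (0, 0, 0)).1 = 0 ∨ (lis.getD i 0 = labs.getD j 0 ∧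
            (newEnt c (ords.getD (lis.getD i 0) []) (as.getD i 0) (β.getD j 0) (pss.getD i [])
              ((rows.getD i []).getD j (0, 0, 0)) (cols.getD j 0)).1 = true)))
  | [], pss, lis, as, _, _, _, _ => by simp [rowsStep2]
  | row :: rows, ps :: pss, li :: lis, a :: as, hp, hl, ha, hw => by
    have hrow : row.length = w := hw row (by simp)
    have ih := rowsStep2_spec c ords cols labs β w hcols hlabs hβ rows pss lis as (by simpa using hp) (by simpa using hl)
      (by simpa using ha) (fun r hr => hw r (List.mem_cons_of_mem _ hr))
    have hr := rowStep2_spec c (ords.getD li []) a li ps row cols labs β (by rw [hcols, hrow]) (by rw [hlabs, hrow])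
      (by rw [hβ, hrow])
    refine ⟨by simp [rowsStep2, ih.1], fun i hi => ?_⟩
    rcases i with _ | i
    · simp only [rowsStep2, List.getD_cons_zero]
      refine ⟨by rw [hr.1, hrow], fun j hj => hr.2.1 j (by rw [hrow]; exact hj), fun hok j hj => ?_⟩
      simp only [Bool.and_eq_true] at hok
      exact hr.2.2 hok.1 j (by rw [hrow]; exact hj)
    · simp only [rowsStep2, List.getD_cons_succ]
      have ih' := ih.2 i (by simpa using hi)
      refine ⟨ih'.1, ih'.2.1, fun hok j hj => ?_⟩
      simp only [Bool.and_eq_true] at hok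
      exact ih'.2.2 hok.2 j hj
  | row :: rows, [], lis, as, hp, _, _, _ => by simp at hp
  | row :: rows, ps :: pss, [], as, _, hl, _, _ => by simp at hl
  | row :: rows, ps :: pss, li :: lis, [], _, _, ha, _ => by simp at ha

/-- What `wellSized` says. -/
theorem wellSized_spec {I : Inst} (h : wellSized n I = true) :
    I.sup.length = n ∧ I.col.length = n ∧ I.ent.length = n ∧ ∀ row ∈ I.ent, row.length = n := by
  simp only [wellSized, Bool.and_eq_true, decide_eq_true_eq, List.all_eq_true] at h
  exact ⟨h.1.1.1, h.1.1.2, h.1.2, h.2⟩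

/-- Two lists of length `n` with equal `getD` entries are equal. -/
theorem list_eq_of_getD {α : Type} (d : α) {l₁ l₂ : List α} (h₁ : l₁.length = n) (h₂ : l₂.length = n)
    (h : ∀ i, i < n → l₁.getD i d = l₂.getD i d) : l₁ = l₂ := by
  apply List.ext_getElem (by rw [h₁, h₂])
  intro i hi₁ hi₂
  have := h i (by rw [← h₁]; exact hi₁)
  rwa [List.getD_eq_getElem _ _ hi₁, List.getD_eq_getElem _ _ hi₂] at this

/-- **The v2 split computes the v1 split** (and its flag implies the v1 flag). -/
theorem splitStep2_eq (c : ℕ) (lab : List ℕ) (ords : List (List ℕ)) (α β : List ℕ) (I : Inst)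
    (hok : (splitStep2 k n c lab ords α β I).1 = true) :
    (splitStep k n c lab ords α β I).1 = true ∧ (splitStep2 k n c lab ords α β I).2 = (splitStep k n c lab ords α β I).2 := by
  simp only [splitStep2, Bool.and_eq_true, decide_eq_true_eq] at hok
  obtain ⟨⟨⟨⟨⟨hc, hlab⟩, hα⟩, hβ⟩, hws⟩, hr⟩ := hok
  obtain ⟨hsup, hcol, hent, hrows⟩ := wellSized_spec hws
  have spec := rowsStep2_spec c ords I.col lab β n hcol hlab hβ I.ent I.sup lab α (by rw [hsup, hent]) (by rw [hlab, hent])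
    (by rw [hα, hent]) hrows
  constructor
  · simp only [splitStep, Bool.and_eq_true, decide_eq_true_eq, List.all_eq_true, List.mem_range, Bool.or_eq_true]
    refine ⟨hc, fun i hi j hj => ?_⟩
    have := (spec.2 i (by rw [hent]; exact hi)).2.2 hr j hj
    exact this
  · simp only [splitStep2, splitStep]
    congr 1
    · refine list_eq_of_getD [] (by rw [spec.1, hent]) (List.length_ofFn) fun i hi => ?_
      rw [getD_ofFn _ _ hi]
      refine list_eq_of_getD (0, 0, 0) (spec.2 i (by rw [hent]; exact hi)).1 (List.length_ofFn) fun j hj => ?_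
      rw [getD_ofFn _ _ hj, (spec.2 i (by rw [hent]; exact hi)).2.1 j hj]
      rfl
    · refine list_eq_of_getD 0 (by rw [List.length_map, hcol]) (List.length_ofFn) fun j hj => ?_
      rw [getD_ofFn _ _ hj, List.getD_eq_getElem _ _ (by rw [List.length_map, hcol]; exact hj), List.getElem_map,
        Inst.colN, List.getD_eq_getElem _ _ (by rw [hcol]; exact hj)]

/-- **The v2 permutation computes the v1 permutation.** -/
theorem permStep2_eq (σ : List ℕ) (I : Inst) (hok : (permStep2 n σ I).1 = true) :
    (permStep n σ I).1 = true ∧ (permStep2 n σ I).2 = (permStep n σ I).2 := by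
  simp only [permStep2, Bool.and_eq_true, decide_eq_true_eq, List.all_eq_true, List.mem_range] at hok
  obtain ⟨⟨⟨⟨hlt, hnd⟩, hσ⟩, hws⟩, hn⟩ := hok
  obtain ⟨hsup, hcol, hent, hrows⟩ := wellSized_spec hws
  have hne : I.ent ≠ [] := by intro h; rw [h] at hent; simp at hent; omega
  obtain ⟨htlen, htcol⟩ := tr_getD (0, 0, 0) I.ent n hne hrows
  -- the permuted columns
  set permT := σ.map fun j => (tr I.ent).getD j [] with hpermT
  have hpermT_len : permT.length = n := by rw [hpermT, List.length_map, hσ]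
  have hpermT_get : ∀ j, j < n → permT.getD j [] = I.ent.map fun r => r.getD (σ.getD j 0) (0, 0, 0) := by
    intro j hj
    rw [hpermT, List.getD_eq_getElem _ _ (by rw [List.length_map, hσ]; exact hj), List.getElem_map,
      ← List.getD_eq_getElem σ 0 (by rw [hσ]; exact hj)]
    exact htcol _ (hlt j hj)
  have hpermT_rows : ∀ r ∈ permT, r.length = n := by
    intro r hr
    obtain ⟨j, hj, rfl⟩ := List.getElem_of_mem hr
    have := hpermT_get j (by rw [← hpermT_len]; exact hj)
    rw [List.getD_eq_getElem _ _ hj] at this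
    rw [this, List.length_map, hent]
  have hne2 : permT ≠ [] := by intro h; rw [h] at hpermT_len; simp at hpermT_len; omega
  obtain ⟨h2len, h2col⟩ := tr_getD (0, 0, 0) permT n hne2 hpermT_rows
  constructor
  · simp only [permStep, Bool.and_eq_true, decide_eq_true_eq, List.all_eq_true, List.mem_range]
    exact ⟨hlt, hnd⟩
  · simp only [permStep2, permStep]
    congr 1
    · refine list_eq_of_getD [] h2len (List.length_ofFn) fun i hi => ?_
      rw [getD_ofFn _ _ hi, h2col i hi]
      refine list_eq_of_getD (0, 0, 0) (by rw [List.length_map, hpermT_len]) (List.length_ofFn) fun j hj => ?_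
      rw [getD_ofFn _ _ hj, List.getD_eq_getElem _ _ (by rw [List.length_map, hpermT_len]; exact hj), List.getElem_map,
        ← List.getD_eq_getElem permT [] (by rw [hpermT_len]; exact hj), hpermT_get j hj,
        List.getD_eq_getElem _ _ (by rw [List.length_map, hent]; exact hi), List.getElem_map, Inst.entL,
        List.getD_eq_getElem I.ent [] (by rw [hent]; exact hi)]
    · refine list_eq_of_getD 0 (by rw [List.length_map, hσ]) (List.length_ofFn) fun j hj => ?_
      rw [getD_ofFn _ _ hj, List.getD_eq_getElem _ _ (by rw [List.length_map, hσ]; exact hj), List.getElem_map,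
        ← List.getD_eq_getElem σ 0 (by rw [hσ]; exact hj)]

/-- **v2 ⇒ v1**: a certificate accepted by the quadratic checker is accepted by the landed checker. -/
theorem check_of_check2 : ∀ (ls : List Level) (I : Inst), check2 k n ls I = true → check k n ls I = true
  | [], I, h => h
  | Level.perm σ :: ls, I, h => by
    rw [check2, Bool.and_eq_true] at h
    obtain ⟨h1, h2⟩ := permStep2_eq σ I h.1
    rw [check, Bool.and_eq_true, ← h2]
    exact ⟨h1, check_of_check2 ls _ h.2⟩
  | Level.split c lab ords α β :: ls, I, h => by
    rw [check2, Bool.and_eq_true] at h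
    obtain ⟨h1, h2⟩ := splitStep2_eq c lab ords α β I h.1
    rw [check, Bool.and_eq_true, ← h2]
    exact ⟨h1, check_of_check2 ls _ h.2⟩

end Equiv2

end Cert
end Summit.ValiantsHypothesis.ValiantsHypothesis.Theorems.BarrierLever.ChowBenchmarkSplit
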